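import Summits.CriticalPhenomena.PercolationContinuityZ3.Theorems.Transplant.PlanarSkeletonFrmFromDefs
import Summits.CriticalPhenomena.PercolationContinuityZ3.Theorems.Transplant.SkelFrmFromBChoiceNums
import Summits.CriticalPhenomena.PercolationContinuityZ3.Theorems.Transplant.SkelFrmBChoiceNums
import Summits.CriticalPhenomena.PercolationContinuityZ3.Theorems.Transplant.SkelFrmFromBParamsFaceRoomsA
import Summits.CriticalPhenomena.PercolationContinuityZ3.Theorems.Transplant.SkelFrmBParamsFaceRoomsA
import HarnessLib
import Summits.CriticalPhenomena.PercolationContinuityZ3.Theorems.Transplant.SkelFrmBParamsFaceRoomsAR0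
/-!
# U-WAVE PORT (RULING D-U, lead g21 2026-08-26; WAVE-U-MANIFEST v3.1 row «SkelFrmBParamsFaceRoomsAR0» ↦ «SkelFrmFromBParamsFaceRoomsAR0») of the tree module
# `Transplant/SkelFrmBParamsFaceRoomsAR0` onto the carrier `PlanarSkeletonFrmFrom` (frames only, cylinders connected from width `ℓ₀` on)

ORIGINAL TITLE: N2 (frames-only node `SamePDropOfSkeletonFrmFrom₁`, OPEN) params column over `PlanarSkeletonFrm` — (F) value layer, **J19 / R0 SUCCESSOR of

builds on p205010 (kernel theorem, internal audit signed; external expert review pending) — nothing in this file uses p205010; NOTHING is claimed about the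
OPEN node U `SamePDropOfSkeletonFrmFrom₁` (nor U_s / the end state).  Lane `prim-bschramm`, seat `prim-bschramm-stmt` gen 26 (port pen, RULING M-11 family P-stmt; tool = p3-g26's port_u.py of record, registry-driven inputs); helper file
(`--supports stmt-CriticalPhenomena-4575 --as helper`).  PORT RULES r1–r4 of RULING D-U: declaration order and proof texts are those of the original,
byte-identical except (i) the carrier token `PlanarSkeletonFrm ↦ PlanarSkeletonFrmFrom` (binders, `namespace`/`end` lines, qualified names of twinned
declarations), (ii) carrier-FREE declarations of the original (φ-level `Skelφ…` blocks and namespace-only arithmetic residents) are NOT re-declared —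
this file imports the original and `export`s the twin-free residents (POLICY T / treatment (m1)); residents whose statement mentions a twinned
constant are copied, (iii) every carrier-binding declaration keeps its explicit binder `(Φ : PlanarSkeletonFrmFrom G)` in its own signature (r2).  Docstrings and citations are the original's.
-/

noncomputable section

open scoped Classical

namespace Summit.CriticalPhenomena.PercolationContinuityZ3.Theorems.Transplant

namespace PlanarSkeletonFrmFrom

namespace NegB

open Literature.Probability.Percolation Literature.Probability.LatticeModels SimpleGraph
open Literature.Probability.Percolation.KozmaNitzan.Cells (oth)
open SkelConc (Consts)
open Skelφ.StepI (DataN)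
open Neg

/-! ## Levels vs cells at the (S0) kit (at `g := KS.gT mk gx`) -/

section Rooms

/-- `Rlev0 ≤ R′0` (`R′0 = Rlev0 + 1`) — the `hRl` of `hkF_R0A` at `Rl := Rlev0`; the R′0 successor of `RlevA_le_RA'`. [folklore] -/
theorem Rlev0_le_R'0 (κ : Consts) {V : Type} [DecidableEq V] [Countable V] {G : SimpleGraph V} [G.LocallyFinite] (Φ : PlanarSkeletonFrmFrom G) (t : V) (p : unitInterval) (D : Skelφ.StepI.DataNS V) (mk : ℕ) :
    KS0.Rlev0 κ Φ t p D mk ≤ KS0.R'0 κ Φ t p D mk := by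
  rw [← (KS0.R'0_eq κ Φ t p D mk).2.1]; exact Nat.le_succ _

/-- **Levels of the (S0) kit vs the (ζ′) cells** at `g := gT`, axis `i`, under the stride floor `hsR0 : 6·R'0 + 11 ≤ s_i` (J19 floor-as-hypothesis):
`Rlev0 + 4 ≤ 10·s_i` and `Rlev0 + 4 ≤ 3·r_i` (hp-8's `hRlev/hRlev'`; `R′0 = Rlev0 + 1`, `r_i = K·s_i`, `K ≥ 40`) — the R′0 successor of `hRlev_RA`. [folklore] -/
theorem hRlev_R0 (κ : Consts) {V : Type} [DecidableEq V] [Countable V] {G : SimpleGraph V} [G.LocallyFinite] (Φ : PlanarSkeletonFrmFrom G) (t : V) (p : unitInterval) (D : Skelφ.StepI.DataNS V) (f : ℕ) (mk : ℕ) (gx : Neg.FSlot)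
    (i : Fin 2) (hsR0 : 6 * (KS0.R'0 κ Φ t p D mk : ℤ) + 11 ≤ (((fcellsA κ Φ t p D (KS.gT mk gx κ Φ t p D) f).s i : ℕ) : ℤ)) :
    KS0.Rlev0 κ Φ t p D mk + 4 ≤ 10 * (fcellsA κ Φ t p D (KS.gT mk gx κ Φ t p D) f).s i ∧ KS0.Rlev0 κ Φ t p D mk + 4 ≤ 3 * (fcellsA κ Φ t p D (KS.gT mk gx κ Φ t p D) f).r i := by
  have hR := (KS0.R'0_eq κ Φ t p D mk).2.1
  have hr := (fcellsA_K κ Φ t p D (KS.gT mk gx κ Φ t p D) f).2.2 i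
  have hK := (Neg.forty_le_K κ).1
  have hs : KS0.R'0 κ Φ t p D mk + 3 ≤ (fcellsA κ Φ t p D (KS.gT mk gx κ Φ t p D) f).s i := by
    have : ((KS0.R'0 κ Φ t p D mk : ℕ) : ℤ) + 3 ≤ (((fcellsA κ Φ t p D (KS.gT mk gx κ Φ t p D) f).s i : ℕ) : ℤ) := by linarith
    exact_mod_cast this
  constructor
  · omega
  · rw [hr]; nlinarith

/-- **Levels vs cells from the BOX FLOOR** `hMR0 : 4·K·(R'0+2) ≤ M_L (gT mk gx)`, both axes (`KS.sA_ge_of_floor'`). [folklore] -/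
theorem hRlev_R0_of_box (κ : Consts) {V : Type} [DecidableEq V] [Countable V] {G : SimpleGraph V} [G.LocallyFinite] (Φ : PlanarSkeletonFrmFrom G) (t : V) (p : unitInterval) (D : Skelφ.StepI.DataNS V) (f : ℕ) (mk : ℕ) (gx : Neg.FSlot) (hN : EqNumL κ Φ t p D (KS.gT mk gx κ Φ t p D) f) (hκ : (hL κ Φ t p D (KS.gT mk gx κ Φ t p D) f).natAbs ≤ 10 * nL κ Φ t p D (KS.gT mk gx κ Φ t p D) f)
    (hMR0 : 4 * Neg.K κ * (KS0.R'0 κ Φ t p D mk + 2) ≤ ML κ Φ t p D (KS.gT mk gx κ Φ t p D)) (i : Fin 2) :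
    KS0.Rlev0 κ Φ t p D mk + 4 ≤ 10 * (fcellsA κ Φ t p D (KS.gT mk gx κ Φ t p D) f).s i ∧ KS0.Rlev0 κ Φ t p D mk + 4 ≤ 3 * (fcellsA κ Φ t p D (KS.gT mk gx κ Φ t p D) f).r i := by
  obtain ⟨h0, h1⟩ := KS.sA_ge_of_floor' κ Φ t p D (KS.gT mk gx κ Φ t p D) f hN hκ hMR0
  have hR : (0 : ℤ) ≤ (KS0.R'0 κ Φ t p D mk : ℤ) := Nat.cast_nonneg _
  refine hRlev_R0 κ Φ t p D f mk gx i ?_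
  obtain rfl | rfl : i = 0 ∨ i = 1 := by fin_cases i <;> simp
  · exact h0
  · linarith

end Rooms

end NegB

end PlanarSkeletonFrmFrom

end Summit.CriticalPhenomena.PercolationContinuityZ3.Theorems.Transplant

end
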